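import Summits.CriticalPhenomena.PercolationContinuityZ3.Theses.PercNonProliferation
import HarnessLib

/-!
# Crux `PercNonProliferation.NonProliferation` (stmt-CriticalPhenomena-4444), line `boundary-pinning` — stub `stub_layerCake`

Helper file for the lead's skeleton of line `boundary-pinning` (payload slug `Sketch`,
prover-line-stmt-CriticalPhenomena-4444-c1).
Proves exactly the registered stub signature `stub_layerCake`; lands with
`--supports stmt-CriticalPhenomena-4444`.

Pure measure theory ("finite layer cake" / Markov glue). For a probability measure `μ`, measurable
events `A k` (`k < K`, think `A k = {N ≥ k + 1}`), finitely many measurable events `B Q` (`Q ∈ 𝒬`)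
with weights `c Q ≥ 0` and a constant `c₀ ≥ 0`, the a.e. pointwise bound
`ω ∈ A k (k < K) ⇒ k + 1 ≤ G ω`, where `G ω := c₀ + Σ_{Q ∈ 𝒬} c_Q 1[B Q](ω)`, integrates to
`Σ_{k < K} μ(A k) ≤ c₀ + Σ_{Q ∈ 𝒬} c_Q μ(B Q)`.

* Pointwise (`StubLayerCake.sum_indicator_le`, induction on `K`): `Σ_{k < K} 1[A k](ω) ≤ G ω`.
  Indeed if `ω ∈ A K` then `Σ_{k < K + 1} 1[A k](ω) ≤ K + 1 ≤ G ω` by the hypothesis at `K`, and if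
  `ω ∉ A K` the last indicator vanishes and the induction hypothesis applies (the base case `K = 0`
  is `0 ≤ G ω`, from `c₀, c_Q ≥ 0`). Antitonicity of `A` is not needed for this.
* Integrate (`StubLayerCake.layerCake`): `Σ_k μ(A k) = ∫ Σ_k 1[A k] dμ ≤ ∫ G dμ = c₀ + Σ_Q c_Q μ(B Q)`
  (`integral_indicator_const`, `integral_finsetSum`, `integral_mono_ae`, `probReal_univ`).
-/

noncomputable section

namespace Summit.CriticalPhenomena.PercolationContinuityZ3.Theorems.NonProliferation

open MeasureTheory Filter Topology
open Literature.Probability.LatticeModels Literature.Probability.Percolation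

namespace StubLayerCake

/-- Pointwise finite layer cake: if `ω ∈ A k ⇒ k + 1 ≤ g` for every `k < K` and `0 ≤ g`, then
`Σ_{k < K} 1[A k](ω) ≤ g` (induction on `K`; no monotonicity of `A` is needed). -/
theorem sum_indicator_le {Ω : Type*} {A : ℕ → Set Ω} {ω : Ω} {g : ℝ} (hg : 0 ≤ g) {K : ℕ}
    (hK : ∀ k < K, ω ∈ A k → (k + 1 : ℝ) ≤ g) :
    ∑ k ∈ Finset.range K, (A k).indicator (fun _ => (1 : ℝ)) ω ≤ g := by
  induction K with
  | zero => simpa using hg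
  | succ K ih =>
    by_cases hω : ω ∈ A K
    · calc ∑ k ∈ Finset.range (K + 1), (A k).indicator (fun _ => (1 : ℝ)) ω
          ≤ ∑ _k ∈ Finset.range (K + 1), (1 : ℝ) :=
            Finset.sum_le_sum fun k _ =>
              Set.indicator_apply_le' (fun _ => le_rfl) (fun _ => zero_le_one)
        _ = K + 1 := by simp
        _ ≤ g := hK K K.lt_succ_self hω
    · rw [Finset.sum_range_succ, Set.indicator_of_notMem hω, add_zero]
      exact ih fun k hk => hK k (Nat.lt_succ_of_lt hk)

/-- **Finite layer cake** on a general probability space: for measurable `A k`, `B Q`, weights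
`c Q ≥ 0`, `c₀ ≥ 0`, the a.e. bound `ω ∈ A k (k < K) ⇒ k + 1 ≤ c₀ + Σ_{Q ∈ 𝒬} c_Q 1[B Q](ω)`
integrates to `Σ_{k < K} μ(A k) ≤ c₀ + Σ_{Q ∈ 𝒬} c_Q μ(B Q)`. -/
theorem layerCake {Ω ι : Type*} [MeasurableSpace Ω] (μ : Measure Ω) [IsProbabilityMeasure μ]
    (K : ℕ) (A : ℕ → Set Ω) (𝒬 : Finset ι) (B : ι → Set Ω) (c₀ : ℝ) (c : ι → ℝ)
    (hA : ∀ k, MeasurableSet (A k)) (hB : ∀ Q, MeasurableSet (B Q))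
    (h0 : 0 ≤ c₀) (hc : ∀ Q, 0 ≤ c Q)
    (H : ∀ᵐ ω ∂μ, ∀ k < K, ω ∈ A k →
      (k + 1 : ℝ) ≤ c₀ + ∑ Q ∈ 𝒬, (B Q).indicator (fun _ => c Q) ω) :
    ∑ k ∈ Finset.range K, μ.real (A k) ≤ c₀ + ∑ Q ∈ 𝒬, c Q * μ.real (B Q) := by
  have hFi : ∀ k ∈ Finset.range K, Integrable ((A k).indicator fun _ => (1 : ℝ)) μ :=
    fun k _ => (integrable_const (1 : ℝ)).indicator (hA k)
  have hGi : ∀ Q ∈ 𝒬, Integrable ((B Q).indicator fun _ => c Q) μ :=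
    fun Q _ => (integrable_const (c Q)).indicator (hB Q)
  have hLHS : ∑ k ∈ Finset.range K, μ.real (A k)
      = ∫ ω, ∑ k ∈ Finset.range K, (A k).indicator (fun _ => (1 : ℝ)) ω ∂μ := by
    rw [integral_finsetSum _ hFi]
    refine Finset.sum_congr rfl fun k _ => ?_
    rw [integral_indicator_const _ (hA k), smul_eq_mul, mul_one]
  have hRHS : ∫ ω, (c₀ + ∑ Q ∈ 𝒬, (B Q).indicator (fun _ => c Q) ω) ∂μ
      = c₀ + ∑ Q ∈ 𝒬, c Q * μ.real (B Q) := by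
    rw [integral_add (integrable_const c₀) (integrable_finsetSum _ hGi), integral_const,
      probReal_univ, one_smul, integral_finsetSum _ hGi]
    congr 1
    refine Finset.sum_congr rfl fun Q _ => ?_
    rw [integral_indicator_const _ (hB Q), smul_eq_mul, mul_comm]
  rw [hLHS, ← hRHS]
  refine integral_mono_ae (integrable_finsetSum _ hFi)
    ((integrable_const c₀).add (integrable_finsetSum _ hGi)) ?_
  filter_upwards [H] with ω hω
  have hg : 0 ≤ c₀ + ∑ Q ∈ 𝒬, (B Q).indicator (fun _ => c Q) ω :=
    add_nonneg h0 (Finset.sum_nonneg fun Q _ => Set.indicator_nonneg (fun _ _ => hc Q) _)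
  exact sum_indicator_le hg hω

end StubLayerCake

/-- **Stub `stub_layerCake`** of line `boundary-pinning` (crux stmt-CriticalPhenomena-4444): the
finite layer-cake / Markov glue. For a probability measure `μ` on bond configurations of `ℤ^d`,
measurable `A k` (antitone in `k`; think `A k = {N_n ≥ k + 1}`), finitely many measurable cells'
events `B Q` with weights `c Q ≥ 0` and `c₀ ≥ 0`, the a.e. pointwise bound
`ω ∈ A k (k < K) ⇒ k + 1 ≤ c₀ + Σ_Q c_Q 1[B Q](ω)` integrates to
`Σ_{k < K} μ(A k) ≤ c₀ + Σ_Q c_Q μ(B Q)` (`StubLayerCake.layerCake`; the antitonicity hypothesis is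
not used). -/
theorem stub_layerCake :
  ∀ (d : ℕ) (μ : Measure (BondConfig (Site d))) [IsProbabilityMeasure μ] (K : ℕ)
    (A : ℕ → Set (BondConfig (Site d))) (𝒬 : Finset (Finset (Site d)))
    (B : Finset (Site d) → Set (BondConfig (Site d))) (c₀ : ℝ) (c : Finset (Site d) → ℝ),
    (∀ k, MeasurableSet (A k)) → (∀ Q, MeasurableSet (B Q)) →
    (∀ k k', k ≤ k' → A k' ⊆ A k) → 0 ≤ c₀ → (∀ Q, 0 ≤ c Q) →
    (∀ᵐ ω ∂μ, ∀ k < K, ω ∈ A k → (k + 1 : ℝ) ≤ c₀ + ∑ Q ∈ 𝒬, (B Q).indicator (fun _ => c Q) ω) →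
    ∑ k ∈ Finset.range K, μ.real (A k) ≤ c₀ + ∑ Q ∈ 𝒬, c Q * μ.real (B Q) := by
  intro d μ _ K A 𝒬 B c₀ c hA hB _hmono h0 hc H
  exact StubLayerCake.layerCake μ K A 𝒬 B c₀ c hA hB h0 hc H

end Summit.CriticalPhenomena.PercolationContinuityZ3.Theorems.NonProliferation

end
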